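import Summits.BirchSwinnertonDyer.BirchSwinnertonDyer.Theorems.CumulativeHeegnerLeopoldtWAllExclAddWildRankOneOfCharacterCut
import Summits.BirchSwinnertonDyer.BirchSwinnertonDyer.Theorems.UniversalToricDescentWildSplitFrameAtThreeOddOfPrintOfEngine
import HarnessLib

/-!
# Closer of item 23971 `LeopoldtKernelAtThreeOfPrintOdd` (TURNKEY drafted by pen pss3 g21; to be landed by a prover)

Route `CumulativeHeegnerLeopoldt` rev 7 (K2-ODD CUT) filed the kernel♯ item `LeopoldtKernelAtThreeOfPrintOdd` = item 25837
`LeopoldtKernelAtThreeOfPrint` with its K2 binder replaced by `EisensteinCharacterInvariantsAtThreeOdd` (K2 at odd `d_K`).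
The kernel with K2 fed at odd `d_K` is ALREADY the tree theorem
`leopoldtKernelAtThree_of_not_hasCM_of_frameOdd_of_oddK2` (p684759, chl-p1 g9): the Friedberg–Hoffstein field with
auxiliary modulus `2` has odd discriminant, so K2 is consumed only there. The closer is the one-line re-binding, with the
odd-`d_K` wild split frame supplied by the tree theorem `wildSplitFrameAtThreeOddOfPrint_proof` (p596578) exactly as in
`leopoldtKernelAtThree_of_not_hasCM_of_printedInputs`. CONDITIONAL on every displayed antecedent (published inputs, LZZ,
K1, K2-odd, the printed wild-split package, K4, K5); BSD is not proved for any curve by this.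
-/

namespace Summit.BirchSwinnertonDyer.BirchSwinnertonDyer.Theorems

open Summit.BirchSwinnertonDyer.BirchSwinnertonDyer.Theses.CumulativeHeegnerLeopoldt

/-- **Item 23971 `LeopoldtKernelAtThreeOfPrintOdd` holds**: published inputs → LZZ → K1 → K2-odd →
`WildSplitPrintedInputsAtThree` → K4 → K5 ⟹ `BSD₃(E)` for every globally minimal non-CM `E/ℚ` on `ClassO6 W 3` with
`r_an = 1`, `E[3]` reducible and a non-anomalous rational line — by `leopoldtKernelAtThree_of_not_hasCM_of_frameOdd_of_oddK2`
with the odd frame `wildSplitFrameAtThreeOddOfPrint_proof`. Every antecedent is a displayed hypothesis of the item.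
[cite: JetchevSkinnerWan2017, §7.4.1 (arXiv:1512.06894 p. 30)] [cite: FriedbergHoffstein1995, Thm. B]
[cite: Hsieh2014, Thm. A] [cite: BertoliniDarmonPrasanna2013, Thm. 5.5] -/
theorem cumulativeHeegnerLeopoldt_leopoldtKernelAtThreeOfPrintOdd_proof :
    Summit.BirchSwinnertonDyer.BirchSwinnertonDyer.Theses.CumulativeHeegnerLeopoldt.LeopoldtKernelAtThreeOfPrintOdd :=
  fun hF hL h1 h2 hW h4 h5 W _ _ hCM hO6 hr hRed hcell =>
    leopoldtKernelAtThree_of_not_hasCM_of_frameOdd_of_oddK2 hF hL h1 h2 hW wildSplitFrameAtThreeOddOfPrint_proof h4 h5 W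
      hCM hO6 hr hRed hcell

end Summit.BirchSwinnertonDyer.BirchSwinnertonDyer.Theorems
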